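import Summits.BirchSwinnertonDyer.BirchSwinnertonDyer.Theorems.AdditiveKolyvaginRoadIso
import Summits.BirchSwinnertonDyer.BirchSwinnertonDyer.Theorems.AdditiveKolyvaginRoadLevelMembership
import HarnessLib

/-!
# Route `AdditiveKolyvaginRoad`, crux KS′ `LevelKolyvaginSystemsAdditive` (stmt-BirchSwinnertonDyer-21396) ∕ KPA′ (stmt-BirchSwinnertonDyer-21400):
# SWITCHED CANONICAL SPACES, part 5 — BRIDGES: (i) the unswitched space `SelQP` is the switched one with `Λ` = E's Kummer conditions above `T`
# (so A1 is a special case of `switched_rankLowering`); (ii) the sign-free switched group is the SELMER GROUP OF A SELMER STRUCTURE (X11b currency)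
# (cell `pub/bsd-wall`, width seat `bsd-wall-akr-p2x-w3` g10; `--supports stmt-BirchSwinnertonDyer-21396`, helper; E-side glue; companion of
# `…SwitchedIso.lean` (p639624), `…SwitchedRankLowering.lean` (p640569), `…SwitchedLevelDescent.lean`, `…SwitchedEigen.lean`)

WHY. Two pieces of bookkeeping that make the switched rank lowering usable. (i) Sanity ∕ generality: with `Λ := ⨅_{v above T} 𝓚_v` (E's own
Kummer conditions above the switched set) the switched canonical space `levelSelmerSubgroupP n T μ ⊓ Λ` is the unswitched `levelSelmerSubgroupP n ∅ μ`
— the landed A1 `stub_rankLoweringAdditive` is the special case of part 2's `switched_rankLowering`, and no generality was lost. (ii) The parity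
leg of the «FL-engine» (card `irred-vertex-anchor` T2) compares the sign-free switched group `D = (𝓚 at ∞ and off T) ⊓ Λ` (part 4:
`dim D = dim Sw(+) + dim Sw(−)`) with E's `p`-Selmer group through one-place Lagrangian switches, which live in the SELMER-STRUCTURE currency of
`Summit.BirchSwinnertonDyer.Rank1Residual.X11b` (`SelmerStructure`, `selmerGroup`, `kummerSelmerStructure`, `Function.update`;
`LagrangianSwitchAtP.natCard_selmerGroup_switch`). This file identifies `D`, for `Λ = Λ_𝓕 := ⨅_{v above T} loc_v⁻¹(𝓕_v)`, with the Selmer group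
`H¹_𝓕(K, E[p])` of ANY Selmer structure `𝓕` agreeing with `𝓚` at ∞ and off `T` (e.g. `𝓕 = 𝓚[𝔭 ↦ L][𝔭̄ ↦ L̄]`), and transfers the isotropy
hypothesis.

WHAT (namespace `…Theorems.AdditiveKoly`).
* §1 `levelSelmerSubgroupP_relaxed_inf_kummer_eq` — `levelSelmerSubgroupP n T μ ⊓ (⨅_{v above T} 𝓚_v) = levelSelmerSubgroupP n ∅ μ` when `T` is
  disjoint from the level `n` and no place above `T` lies above `n` (definitional bookkeeping).
* §2 **`switchedTotal_eq_selmerGroup`** — for a Selmer structure `𝓕` on `E[p]` equal to `𝓚` at every infinite place and at every finite place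
  above no member of `T`: `(𝓚 at ∞ and off T) ⊓ Λ_𝓕 = 𝓕.selmerGroup` (tree `comap_localization_kummerSelmerStructure`,
  `SelmerStructure.mem_selmerGroup_iff`).
* §3 `switched_isotropy_of_selmerStructure` — if the local conditions `𝓕_v` above `T` are isotropic for the local Weil cup product of a Weil
  datum, then `Λ_𝓕` satisfies the isotropy hypothesis `hΛ` of parts 1–3 for that datum (unfolding).

HONEST FRAMING: theorems only; 0 definitions, 0 named facts, 0 `sorry`; standard axioms. E-side glue; closes nothing. What is still missing for
the card's parity leg: the one-place switch with a NON-Kummer Lagrangian base at the other place above `p` (to compose two switches), and E's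
`p`-Selmer parity at a ♯ frame (stub P of 21400, PUB-shaped). BSD is not proved by any of this.

References: [cite: WZhang2014, §5 (Sel_{𝔭_n})] [cite: MilneADT2006, Ch. I §6 (6.14)] [cite: PoonenRains2012, Prop. 4.10].
-/

-- single-conjunct summit: `Summit.BirchSwinnertonDyer.BirchSwinnertonDyer.…` repeats the name by design
set_option linter.dupNamespace false

noncomputable section

open scoped Classical

namespace Summit.BirchSwinnertonDyer.BirchSwinnertonDyer.Theorems.AdditiveKoly

open CategoryTheory WeierstrassCurve Field Function NumberField IsDedekindDomain
open Literature.NumberTheory.EllipticCurves Literature.NumberTheory.EllipticCurves.ModularForms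
  Literature.NumberTheory.GaloisRepresentations Module
open Literature.NumberTheory.GaloisRepresentations.DiscreteGaloisModule
open Literature.NumberTheory.GaloisCohomology
open scoped ContRepresentation

variable (W : WeierstrassCurve ℚ) (K : Type) [Field K] [NumberField K] (p : ℕ) (c : K ≃ₐ[ℚ] K)

/-! ## §1 The unswitched canonical space is the switched one with `Λ` = E's Kummer conditions above `T` (A1 is a special case) -/

/-- **`SelQP` is a switched space.** If no place above a member of `T` lies above a member of the level `n` (e.g. `T` coprime to `n`)
and `T` is disjoint from `n`, then cutting the `T`-relaxed canonical space by E's Kummer conditions at the places above `T` gives back the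
unrelaxed canonical space: `levelSelmerSubgroupP n T μ ⊓ (⨅_{v above T} 𝓚_v) = levelSelmerSubgroupP n ∅ μ`. So the switched rank lowering
(`switched_rankLowering`, part 2) with `Λ = ⨅_{v above T} 𝓚_v` is the landed A1 `stub_rankLoweringAdditive`. [cite: WZhang2014, §5 (Sel_{𝔭_n})] -/
theorem levelSelmerSubgroupP_relaxed_inf_kummer_eq (n : Finset ℕ) (T : Set ℕ) (μ : Bool)
    (hTn : ∀ v : HeightOneSpectrum (𝓞 K), (∃ t ∈ T, (t : 𝓞 K) ∈ v.asIdeal) → ∀ q ∈ n, (q : 𝓞 K) ∉ v.asIdeal)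
    (hTn' : ∀ t ∈ T, t ∉ n) :
    levelSelmerSubgroupP W K p c n T μ ⊓
        (⨅ (v : HeightOneSpectrum (𝓞 K)) (_ : ∃ t ∈ T, (t : 𝓞 K) ∈ v.asIdeal),
          selmerLocalKer (W.baseChange K) (v.adicCompletion K) ((p ^ 1 : ℕ) : ℤ)) =
      levelSelmerSubgroupP W K p c n ∅ μ := by
  ext x
  rw [AddSubgroup.mem_inf, mem_levelSelmerSubgroupP_iff, mem_levelSelmerSubgroupP_iff, AddSubgroup.mem_iInf]
  simp only [AddSubgroup.mem_iInf, Set.union_empty, Set.mem_empty_iff_false, not_false_eq_true, and_true,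
    Finset.mem_coe]
  constructor
  · rintro ⟨⟨hsgn, hinf, hfin, htor⟩, hT⟩
    refine ⟨hsgn, hinf, fun v hv ↦ ?_, fun q hq v hqv ↦ htor q ⟨hq, fun hT ↦ hTn' q hT hq⟩ v hqv⟩
    · by_cases hex : ∃ t ∈ T, (t : 𝓞 K) ∈ v.asIdeal
      · exact hT v hex
      · push Not at hex
        refine hfin v fun q hq ↦ ?_
        rcases hq with hq | hq
        · exact hv q hq
        · exact hex q hq
  · rintro ⟨hsgn, hinf, hfin, htor⟩
    refine ⟨⟨hsgn, hinf, fun v hv ↦ hfin v fun q hq ↦ hv q (Or.inl hq), fun q hq v hqv ↦ htor q hq.1 v hqv⟩,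
      fun v hv ↦ hfin v fun q hq ↦ hTn v hv q hq⟩

/-! ## §2 The sign-free switched group is the Selmer group of a Selmer structure (bridge to the X11b currency) -/

/-- **BRIDGE TO SELMER STRUCTURES.** Let `𝓕` be a Selmer structure on `E[p]` over `K` (tree `SelmerStructure`: a local condition at every
place) that agrees with E's Kummer structure `𝓚` (`kummerSelmerStructure`) at every infinite place and at every finite place above no member of
`T`. Then the sign-free switched group with `Λ_𝓕 := ⨅_{v above T} loc_v⁻¹(𝓕_v)` — E's Kummer condition at ∞ and off `T`, `𝓕_v` above `T` — IS
the Selmer group `H¹_𝓕(K, E[p])` of `𝓕` (tree `SelmerStructure.selmerGroup`), as subgroups of `H¹(K, E[p])`. This puts the switched level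
descent (parts 2–3, AKR currency) and the one-place Lagrangian switches (`LagrangianSwitchAtP.natCard_selmerGroup_switch`, Selmer-structure
currency: `𝓕 = 𝓚[𝔭 ↦ L][𝔭̄ ↦ L̄]`) on the same object. [cite: MilneADT2006, Ch. I §6 (6.14)] [folklore] -/
theorem switchedTotal_eq_selmerGroup (T : Set ℕ)
    (𝓕 : SelmerStructure ((W.baseChange K).torsionGaloisModule ((p ^ 1 : ℕ) : ℤ)))
    (hinf : ∀ w : InfinitePlace K,
      𝓕 (Sum.inl w) = (W.baseChange K).kummerSelmerStructure ((p ^ 1 : ℕ) : ℤ) (Sum.inl w))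
    (hfin : ∀ v : HeightOneSpectrum (𝓞 K), (∀ t ∈ T, (t : 𝓞 K) ∉ v.asIdeal) →
      𝓕 (Sum.inr v) = (W.baseChange K).kummerSelmerStructure ((p ^ 1 : ℕ) : ℤ) (Sum.inr v)) :
    ((⨅ (w : InfinitePlace K), selmerLocalKer (W.baseChange K) w.Completion ((p ^ 1 : ℕ) : ℤ)) ⊓
        (⨅ (v : HeightOneSpectrum (𝓞 K)) (_ : ∀ t ∈ T, (t : 𝓞 K) ∉ v.asIdeal),
          selmerLocalKer (W.baseChange K) (v.adicCompletion K) ((p ^ 1 : ℕ) : ℤ))) ⊓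
      (⨅ (v : HeightOneSpectrum (𝓞 K)) (_ : ∃ t ∈ T, (t : 𝓞 K) ∈ v.asIdeal),
        (𝓕 (Sum.inr v)).comap
          (galoisCohomology.localization ((W.baseChange K).torsionGaloisModule ((p ^ 1 : ℕ) : ℤ)) (Sum.inr v) 1)) =
      𝓕.selmerGroup := by
  ext x
  have hsel := SelmerStructure.mem_selmerGroup_iff 𝓕 x
  simp only [AddSubgroup.mem_inf, AddSubgroup.mem_iInf, AddSubgroup.mem_comap]
  constructor
  · rintro ⟨⟨hxinf, hxfin⟩, hxT⟩
    refine hsel.mpr fun v ↦ ?_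
    rcases v with w | v
    · rw [hinf w, ← AddSubgroup.mem_comap, comap_localization_kummerSelmerStructure]
      exact hxinf w
    · by_cases hex : ∃ t ∈ T, (t : 𝓞 K) ∈ v.asIdeal
      · exact hxT v hex
      · push Not at hex
        rw [hfin v hex, ← AddSubgroup.mem_comap, comap_localization_kummerSelmerStructure]
        exact hxfin v hex
  · intro hx'
    have hx := hsel.mp hx'
    refine ⟨⟨fun w ↦ ?_, fun v hv ↦ ?_⟩, fun v _ ↦ hx (Sum.inr v)⟩
    · have h := hx (Sum.inl w)
      rw [hinf w, ← AddSubgroup.mem_comap, comap_localization_kummerSelmerStructure] at h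
      exact h
    · have h := hx (Sum.inr v)
      rw [hfin v hv, ← AddSubgroup.mem_comap, comap_localization_kummerSelmerStructure] at h
      exact h

/-! ## §3 Isotropy of `Λ_𝓕` above `T` from the isotropy of the local conditions of `𝓕` there -/

section Isotropy

variable [Fact p.Prime] [∀ v : Place K, CompactSpace (absoluteGaloisGroup (Place.Completion v))]

/-- If every local condition `𝓕_v` above `T` is isotropic for the local Weil cup product of a Weil datum `e`, then `Λ_𝓕 = ⨅_{v above T} loc_v⁻¹(𝓕_v)`
satisfies the isotropy hypothesis `hΛ` of the switched rank lowering (parts 1–3) for that datum. [cite: PoonenRains2012, Prop. 4.10] [folklore] -/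
theorem switched_isotropy_of_selmerStructure (T : Set ℕ)
    (𝓕 : SelmerStructure ((W.baseChange K).torsionGaloisModule ((p ^ 1 : ℕ) : ℤ)))
    (e : geomTorsion (W.baseChange K) ((p ^ 1 : ℕ) : ℤ) → geomTorsion (W.baseChange K) ((p ^ 1 : ℕ) : ℤ) → AlgebraicClosure K)
    (hμ : ∀ S T, e S T ^ (p ^ 1) = 1)
    (hadd₁ : ∀ S₁ S₂ T, e (S₁ + S₂) T = e S₁ T * e S₂ T)
    (hadd₂ : ∀ S T₁ T₂, e S (T₁ + T₂) = e S T₁ * e S T₂)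
    (hgal : ∀ (σ : absoluteGaloisGroup K) (S T : geomTorsion (W.baseChange K) ((p ^ 1 : ℕ) : ℤ)),
      σ • e S T = e (σ • S) (σ • T))
    (h𝓕 : ∀ v : HeightOneSpectrum (𝓞 K), (∃ t ∈ T, (t : 𝓞 K) ∈ v.asIdeal) →
      ∀ a ∈ 𝓕 (Sum.inr v), ∀ b ∈ 𝓕 (Sum.inr v),
        (weilContPairingLocal (W.baseChange K) (p ^ 1) e hμ hadd₁ hadd₂ hgal (Sum.inr v)).cupProduct a b = 0) :
    ∀ t ∈ T, ∀ w : HeightOneSpectrum (𝓞 K), (t : 𝓞 K) ∈ w.asIdeal →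
      ∀ y ∈ (⨅ (v : HeightOneSpectrum (𝓞 K)) (_ : ∃ t ∈ T, (t : 𝓞 K) ∈ v.asIdeal),
        (𝓕 (Sum.inr v)).comap
          (galoisCohomology.localization ((W.baseChange K).torsionGaloisModule ((p ^ 1 : ℕ) : ℤ)) (Sum.inr v) 1)),
      ∀ z ∈ (⨅ (v : HeightOneSpectrum (𝓞 K)) (_ : ∃ t ∈ T, (t : 𝓞 K) ∈ v.asIdeal),
        (𝓕 (Sum.inr v)).comap
          (galoisCohomology.localization ((W.baseChange K).torsionGaloisModule ((p ^ 1 : ℕ) : ℤ)) (Sum.inr v) 1)),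
        (weilContPairingLocal (W.baseChange K) (p ^ 1) e hμ hadd₁ hadd₂ hgal (Sum.inr w)).cupProduct
          (galoisCohomology.localization ((W.baseChange K).torsionGaloisModule ((p ^ 1 : ℕ) : ℤ)) (Sum.inr w) 1 y)
          (galoisCohomology.localization ((W.baseChange K).torsionGaloisModule ((p ^ 1 : ℕ) : ℤ)) (Sum.inr w) 1 z)
          = 0 := by
  intro t ht w htw y hy z hz
  rw [AddSubgroup.mem_iInf] at hy hz
  have hy' := hy w
  have hz' := hz w
  rw [AddSubgroup.mem_iInf] at hy' hz'
  exact h𝓕 w ⟨t, ht, htw⟩ _ (hy' ⟨t, ht, htw⟩) _ (hz' ⟨t, ht, htw⟩)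

end Isotropy

end Summit.BirchSwinnertonDyer.BirchSwinnertonDyer.Theorems.AdditiveKoly

end
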